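import Literature.Computability.FineGrained.OVFromSETHRoutines
import Literature.Computability.FineGrained.OVFromSETHInstance
import Literature.Computability.Complexity.BlockTuples
import Mathlib.Computability.Encoding
import HarnessLib

/-!
# SETH ⇒ OV (fine-grained.S09): the OV-instance builder, I — ghost parameters, the intended
# memory, and the initialisation (guards, index gadget, header)

Second part of the word-RAM program behind `ovConjectureDet_of_sethWordRAM` (R. Williams,
TCS 348 (2005), §5.1, Thm. 5.1; VVW ICM 2018, Thm. 3.1): the structured code that writes the OV
instance `OVRed.ovInst` of `OVFromSETHInstance.lean` into the region of memory that will be presented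
to the emulated OV algorithm, and its verification in the logic `SProg.Achieves`.

* `OVRed.BP` — the ghost parameters of a build (geometry of the region, the tape left by the
  simulated sparsifier, its symbol codes) and `OVRed.BP.OK` — the side conditions at word size `W`;
  `OVRed.BP.BRegs` — the constant registers computed by the setup phase;
* `OVRed.BP.bheap g FA FB` — **the intended memory**: the header `|y|, N, d` and the cells of
  side `A` (from `uCoord FA`) and side `B` (from `vCoord FB`) inside the region, the frozen data `base`
  outside (two formula lists, because the parser updates the two sides one after the other);
* the initialisation `OVRed.initPhase` = guard column of side `A` (`fillStride`), guard column of side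
  `B`, the index-gadget row loop `OVRed.gadgetRows`, the header; its certificate
  **`OVRed.BP.initPhase_spec`**: from `BRegs` and the data `base` it reaches exactly `bheap g [] []`
  (`OVRed.BP.initFinal_eq_bheap`), within `OVRed.BP.Tinit` steps;
* the region lemmas turning the generic closed forms `strideSet` / `strideAnd` of
  `OVFromSETHRoutines.lean` into statements about rows and coordinates (`OVRed.BP.strideSet_rowAddr`,
  `OVRed.BP.strideAnd_rowAddr`, `OVRed.BP.bheap_A`, `OVRed.BP.bheap_B`, `OVRed.BP.data_ext`),
  reused by the parser (`OVFromSETHParse.lean`).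

[folklore] engineering (Nipkow–Klein, *Concrete Semantics*, §12).
-/

namespace Literature.Computability.FineGrained.OVRed

open Cryptography Cryptography.WordRAM Cryptography.WordRAM.SProg _root_.Computability

/-! ### Ghost parameters -/

/-- The ghost parameters of a build: the frozen data `base` (the memory above address `100` after
the simulation and the setup), the number of variables `n`, the split point `hh` and `H = 2^hh`, the
gadget width `ℓ`, the number of rows `N`, the dimension `d`, the number of clause coordinates `D`,
the base `Bv` of the region, the base `Qtm` of the simulated machine's data with its stack number
`κ` and output-stack index `i₁`, the output string `str` and the symbol code `cd`. [folklore] -/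
structure BP where
  /-- The data memory before the build (cells `≥ 100`). -/
  base : ℕ → ℕ
  /-- Number of variables. -/
  n : ℕ
  /-- Split point: first-half variables are `< hh`. -/
  hh : ℕ
  /-- `H = 2 ^ hh`, the number of half-assignments. -/
  H : ℕ
  /-- Gadget width. -/
  ℓ : ℕ
  /-- Rows per side. -/
  N : ℕ
  /-- Dimension. -/
  d : ℕ
  /-- Number of clause coordinates. -/
  D : ℕ
  /-- Base address of the region (emulated cell `0`). -/
  Bv : ℕ
  /-- Base address of the simulated machine's data. -/
  Qtm : ℕ
  /-- Number of stacks of the simulated machine. -/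
  κ : ℕ
  /-- Index of the output stack. -/
  i₁ : ℕ
  /-- The output string of the sparsifier. -/
  str : List Γ'
  /-- The numeric codes of the string symbols. -/
  cd : Γ' → ℕ

namespace BP

variable (g : BP) {W : ℕ}

/-- Address of `A[0][0]` (emulated cell `3`). [folklore] -/
def Abase : ℕ := g.Bv + 3
/-- `N · d`, the size of one side. [folklore] -/
def Nd : ℕ := g.N * g.d
/-- Address of `B[0][0]`. [folklore] -/
def Bbase : ℕ := g.Abase + g.Nd
/-- The end of the region. [folklore] -/
def rEnd : ℕ := g.Bbase + g.Nd
/-- `H · d`, the stride between the row blocks of consecutive formulas. [folklore] -/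
def Hd : ℕ := g.H * g.d
/-- The length `2 + 2 N d` of the emulated input. [folklore] -/
def ylen : ℕ := 2 + 2 * g.Nd
/-- The guard coordinate `D + 2ℓ`. [folklore] -/
def EX : ℕ := g.D + 2 * g.ℓ
/-- The length of the output string. [folklore] -/
def len : ℕ := g.str.length
/-- The address of the dummy bottom cell of the output stack. [folklore] -/
def bot : ℕ := g.Qtm + g.κ + g.i₁
/-- The address of symbol `s` of the output string (symbol `0` on top). [folklore] -/
def addr (s : ℕ) : ℕ := g.bot + g.κ * (g.len - s)
/-- The code found at position `s`: the code of the symbol, or `0` at the bottom. [folklore] -/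
def tape (s : ℕ) : ℕ := if h : s < g.len then g.cd (g.str[s]) else 0

/-- **Side conditions of a build at word size `W`.** [folklore] -/
structure OK (W : ℕ) : Prop where
  Bv_ge : 100 ≤ g.Bv
  region_le : g.rEnd + g.d ≤ g.Qtm
  i₁_lt : g.i₁ < g.κ
  top_lt : g.bot + g.κ * g.len < 2 ^ W
  base_zero : ∀ a, g.Bv ≤ a → a < g.rEnd → g.base a = 0
  base_tape : ∀ s, s ≤ g.len → g.base (g.addr s) = g.tape s
  base_ptr : g.base (g.Qtm + g.i₁) = g.addr 0
  base_lt : ∀ a, 100 ≤ a → g.base a < 2 ^ W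
  cd_inj : ∀ (s : ℕ) (hs : s < g.str.length) (γ : Γ'), g.cd γ = g.cd (g.str[s]) → γ = g.str[s]
  cd_pos : ∀ γ, 0 < g.cd γ
  cd_lt : ∀ γ, g.cd γ < 2 ^ W
  d_pos : 0 < g.d
  N_pos : 0 < g.N
  H_eq : g.H = 2 ^ g.hh
  EX_lt : g.EX < g.d
  n_bound : 2 * g.n + 2 < 2 ^ W
  one_le_W : 1 ≤ W

/-- **The constant registers** computed by the setup phase and kept throughout the build. [folklore] -/
structure BRegs (m : ℕ → ℕ) : Prop where
  r20 : m 20 = g.n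
  r21 : m 21 = g.hh
  r22 : m 22 = g.H
  r23 : m 23 = g.ℓ
  r25 : m 25 = g.N
  r26 : m 26 = g.d
  r27 : m 27 = g.D
  r28 : m 28 = g.ylen
  r32 : m 32 = g.Bv
  r34 : m 34 = g.Abase
  r35 : m 35 = g.Bbase
  r36 : m 36 = g.Hd
  r38 : m 38 = g.Qtm
  r39 : m 39 = g.EX

variable {g}

/-- `BRegs` survives changes outside the registers `20–39`. [folklore] -/
theorem BRegs.of_frame {m m' : ℕ → ℕ} (h : g.BRegs m)
    (hf : ∀ i, 20 ≤ i → i ≤ 39 → m' i = m i) : g.BRegs m' :=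
  ⟨(hf 20 (by omega) (by omega)).trans h.r20, (hf 21 (by omega) (by omega)).trans h.r21,
    (hf 22 (by omega) (by omega)).trans h.r22, (hf 23 (by omega) (by omega)).trans h.r23,
    (hf 25 (by omega) (by omega)).trans h.r25, (hf 26 (by omega) (by omega)).trans h.r26,
    (hf 27 (by omega) (by omega)).trans h.r27, (hf 28 (by omega) (by omega)).trans h.r28,
    (hf 32 (by omega) (by omega)).trans h.r32, (hf 34 (by omega) (by omega)).trans h.r34,
    (hf 35 (by omega) (by omega)).trans h.r35, (hf 36 (by omega) (by omega)).trans h.r36,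
    (hf 38 (by omega) (by omega)).trans h.r38, (hf 39 (by omega) (by omega)).trans h.r39⟩

variable (g)

/-! ### The intended memory -/

/-- **The intended data memory during the build**: header and the two sides of the instance of
the formula lists `FA` (side `A`) and `FB` (side `B`) inside the region, `base` outside. [folklore] -/
def bheap (FA FB : List (List (List (ℕ × Bool)))) : ℕ → ℕ := fun a =>
  if a = g.Bv then g.ylen
  else if a = g.Bv + 1 then g.N
  else if a = g.Bv + 2 then g.d
  else if g.Abase ≤ a ∧ a < g.Abase + g.Nd then
    (uCoord FA g.hh g.H g.D g.ℓ ((a - g.Abase) / g.d) ((a - g.Abase) % g.d)).toNat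
  else if g.Bbase ≤ a ∧ a < g.Bbase + g.Nd then
    (vCoord FB g.hh g.H g.D g.ℓ ((a - g.Bbase) / g.d) ((a - g.Bbase) % g.d)).toNat
  else g.base a

/-! ### Geometry of the region -/

/-- The standard linear facts of the layout. [folklore] -/
theorem layout : g.Abase = g.Bv + 3 ∧ g.Bbase = g.Abase + g.Nd ∧ g.rEnd = g.Bbase + g.Nd ∧
    g.Nd = g.N * g.d ∧ g.Hd = g.H * g.d ∧ g.ylen = 2 + 2 * g.Nd ∧ g.EX = g.D + 2 * g.ℓ ∧
    g.bot = g.Qtm + g.κ + g.i₁ := ⟨rfl, rfl, rfl, rfl, rfl, rfl, rfl, rfl⟩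

/-- Uniqueness of the (row, coordinate) representation of an address. [folklore] -/
theorem rowAddr_inj {base₀ d r r' j j' : ℕ} (hj : j < d) (hj' : j' < d)
    (h : base₀ + r * d + j = base₀ + r' * d + j') : r = r' ∧ j = j' := by
  have hd : 0 < d := by omega
  have h1 : r * d + j = r' * d + j' := by omega
  have hr : (r * d + j) / d = r := by
    rw [Nat.add_comm, Nat.add_mul_div_right _ _ hd, Nat.div_eq_of_lt hj, Nat.zero_add]
  have hr' : (r' * d + j') / d = r' := by
    rw [Nat.add_comm, Nat.add_mul_div_right _ _ hd, Nat.div_eq_of_lt hj', Nat.zero_add]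
  have hrr : r = r' := by rw [← hr, h1, hr']
  subst hrr
  exact ⟨rfl, by omega⟩

/-- A row address lies inside its side. [folklore] -/
theorem rowAddr_lt {base₀ d r j N : ℕ} (hr : r < N) (hj : j < d) :
    base₀ + r * d + j < base₀ + N * d := by
  have : (r + 1) * d ≤ N * d := Nat.mul_le_mul_right _ hr
  rw [Nat.add_mul, Nat.one_mul] at this; omega

/-- Every address of a side is a row address. [folklore] -/
theorem exists_rowAddr {base₀ d N a : ℕ} (hd : 0 < d) (h1 : base₀ ≤ a) (h2 : a < base₀ + N * d) :
    ∃ r j, r < N ∧ j < d ∧ a = base₀ + r * d + j := by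
  refine ⟨(a - base₀) / d, (a - base₀) % d, ?_, Nat.mod_lt _ hd, ?_⟩
  · exact Nat.div_lt_of_lt_mul (by rw [Nat.mul_comm]; omega)
  · have := Nat.div_add_mod (a - base₀) d
    rw [Nat.mul_comm] at this; omega

/-- **A strided fill restricted to a side**, in (row, coordinate) terms: the cells `(r, j₀)` with
`r₀ ≤ r < r₀ + cnt` receive `v`, all other cells of the side keep their value. [folklore] -/
theorem strideSet_rowAddr {m : ℕ → ℕ} {base₀ d r₀ j₀ cnt v r j : ℕ} (hj₀ : j₀ < d) (hj : j < d) :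
    strideSet m (base₀ + r₀ * d + j₀) d v cnt (base₀ + r * d + j) =
      if j = j₀ ∧ r₀ ≤ r ∧ r < r₀ + cnt then v else m (base₀ + r * d + j) := by
  have hd : 0 < d := by omega
  split_ifs with h
  · obtain ⟨rfl, h1, h2⟩ := h
    have : base₀ + r * d + j = base₀ + r₀ * d + j + (r - r₀) * d := by
      have : r * d = r₀ * d + (r - r₀) * d := by rw [← Nat.add_mul]; congr 1; omega
      omega
    rw [this]
    exact strideSet_apply_hit hd (by omega)
  · refine strideSet_apply_of_forall_ne fun p hp hap => h ?_
    have : base₀ + r * d + j = base₀ + (r₀ + p) * d + j₀ := by rw [hap, Nat.add_mul]; omega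
    obtain ⟨rfl, rfl⟩ := rowAddr_inj hj hj₀ this
    exact ⟨rfl, Nat.le_add_right _ _, by omega⟩

/-- A strided fill inside one side does not touch addresses below that side. [folklore] -/
theorem strideSet_of_lt_base {m : ℕ → ℕ} {base₀ d r₀ j₀ cnt v a : ℕ} (ha : a < base₀) :
    strideSet m (base₀ + r₀ * d + j₀) d v cnt a = m a :=
  strideSet_apply_of_lt (by omega) cnt

/-- A strided fill on rows `< N` of a side does not touch addresses at or past its end. [folklore] -/
theorem strideSet_of_side_end_le {m : ℕ → ℕ} {base₀ d r₀ j₀ cnt v a N : ℕ} (hj₀ : j₀ < d)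
    (hcnt : r₀ + cnt ≤ N) (ha : base₀ + N * d ≤ a) : strideSet m (base₀ + r₀ * d + j₀) d v cnt a = m a := by
  refine strideSet_apply_of_forall_ne fun p hp hap => ?_
  have := rowAddr_lt (base₀ := base₀) (show r₀ + p < N by omega) hj₀
  rw [Nat.add_mul] at this; omega

/-- **A scatter restricted to a side**, in (row, coordinate) terms. [folklore] -/
theorem strideAnd_rowAddr {m : ℕ → ℕ} {base₀ d r₀ j₀ cnt pos r j : ℕ} {b : Bool} (hj₀ : j₀ < d)
    (hj : j < d) :
    strideAnd m (base₀ + r₀ * d + j₀) d pos b cnt (base₀ + r * d + j) =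
      if j = j₀ ∧ r₀ ≤ r ∧ r < r₀ + cnt then m (base₀ + r * d + j) &&& scatterBit pos b (r - r₀)
      else m (base₀ + r * d + j) := by
  have hd : 0 < d := by omega
  split_ifs with h
  · obtain ⟨rfl, h1, h2⟩ := h
    have e : base₀ + r * d + j = base₀ + r₀ * d + j + (r - r₀) * d := by
      have : r * d = r₀ * d + (r - r₀) * d := by rw [← Nat.add_mul]; congr 1; omega
      omega
    rw [e, strideAnd_apply_hit hd (by omega)]
  · refine strideAnd_apply_of_forall_ne fun p hp hap => h ?_
    have : base₀ + r * d + j = base₀ + (r₀ + p) * d + j₀ := by rw [hap, Nat.add_mul]; omega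
    obtain ⟨rfl, rfl⟩ := rowAddr_inj hj hj₀ this
    exact ⟨rfl, Nat.le_add_right _ _, by omega⟩

/-- A scatter inside one side does not touch addresses below that side. [folklore] -/
theorem strideAnd_of_lt_base {m : ℕ → ℕ} {base₀ d r₀ j₀ cnt pos a : ℕ} {b : Bool} (ha : a < base₀) :
    strideAnd m (base₀ + r₀ * d + j₀) d pos b cnt a = m a :=
  strideAnd_apply_of_lt (by omega) cnt

/-- A scatter on rows `< N` of a side does not touch addresses at or past its end. [folklore] -/
theorem strideAnd_of_side_end_le {m : ℕ → ℕ} {base₀ d r₀ j₀ cnt pos a N : ℕ} {b : Bool}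
    (hj₀ : j₀ < d) (hcnt : r₀ + cnt ≤ N) (ha : base₀ + N * d ≤ a) :
    strideAnd m (base₀ + r₀ * d + j₀) d pos b cnt a = m a := by
  refine strideAnd_apply_of_forall_ne fun p hp hap => ?_
  have := rowAddr_lt (base₀ := base₀) (show r₀ + p < N by omega) hj₀
  rw [Nat.add_mul] at this; omega

/-- `bheap` on side `A`, by row and coordinate. [folklore] -/
theorem bheap_A (FA FB : List (List (List (ℕ × Bool)))) {r j : ℕ} (hr : r < g.N) (hj : j < g.d) :
    g.bheap FA FB (g.Abase + r * g.d + j) = (uCoord FA g.hh g.H g.D g.ℓ r j).toNat := by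
  obtain ⟨hA, hB, hE, hNd, -, -, -, -⟩ := g.layout
  have hlt := rowAddr_lt (base₀ := g.Abase) hr hj
  obtain ⟨h1, h2⟩ := Complexity.div_mod_block (k := r) hj
  unfold bheap
  rw [if_neg (by omega), if_neg (by omega), if_neg (by omega), if_pos ⟨by omega, by rw [hNd]; omega⟩,
    Nat.add_assoc, Nat.add_sub_cancel_left, h1, h2]

/-- `bheap` on side `B`, by row and coordinate. [folklore] -/
theorem bheap_B (FA FB : List (List (List (ℕ × Bool)))) {r j : ℕ} (hr : r < g.N) (hj : j < g.d) :
    g.bheap FA FB (g.Bbase + r * g.d + j) = (vCoord FB g.hh g.H g.D g.ℓ r j).toNat := by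
  obtain ⟨hA, hB, hE, hNd, -, -, -, -⟩ := g.layout
  have hlt := rowAddr_lt (base₀ := g.Bbase) hr hj
  obtain ⟨h1, h2⟩ := Complexity.div_mod_block (k := r) hj
  unfold bheap
  rw [if_neg (by omega), if_neg (by omega), if_neg (by omega), if_neg (by rw [hNd]; omega),
    if_pos ⟨by omega, by rw [hNd]; omega⟩, Nat.add_assoc, Nat.add_sub_cancel_left, h1, h2]

/-- `bheap` outside the region is the frozen data. [folklore] -/
theorem bheap_of_not_region (FA FB : List (List (List (ℕ × Bool)))) {a : ℕ}
    (ha : a < g.Bv ∨ g.rEnd ≤ a) : g.bheap FA FB a = g.base a := by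
  obtain ⟨hA, hB, hE, hNd, -, -, -, -⟩ := g.layout
  unfold bheap
  rw [if_neg (by omega), if_neg (by omega), if_neg (by omega), if_neg (by omega), if_neg (by omega)]

/-- **Extensionality over the region**: two memories that agree on the header, on every cell of
both sides (by row and coordinate) and outside the region are equal above `100`. [folklore] -/
theorem data_ext {m m' : ℕ → ℕ} (hd : 0 < g.d)
    (hhead : m g.Bv = m' g.Bv ∧ m (g.Bv + 1) = m' (g.Bv + 1) ∧ m (g.Bv + 2) = m' (g.Bv + 2))
    (hAA : ∀ r j, r < g.N → j < g.d → m (g.Abase + r * g.d + j) = m' (g.Abase + r * g.d + j))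
    (hBB : ∀ r j, r < g.N → j < g.d → m (g.Bbase + r * g.d + j) = m' (g.Bbase + r * g.d + j))
    (hout : ∀ a, 100 ≤ a → (a < g.Bv ∨ g.rEnd ≤ a) → m a = m' a) :
    ∀ a, 100 ≤ a → m a = m' a := by
  obtain ⟨hA, hB, hE, hNd, -, -, -, -⟩ := g.layout
  intro a ha
  by_cases h1 : a < g.Bv
  · exact hout a ha (Or.inl h1)
  by_cases h2 : g.rEnd ≤ a
  · exact hout a ha (Or.inr h2)
  by_cases h3 : a < g.Abase
  · rcases (show a = g.Bv ∨ a = g.Bv + 1 ∨ a = g.Bv + 2 by omega) with rfl | rfl | rfl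
    exacts [hhead.1, hhead.2.1, hhead.2.2]
  by_cases h4 : a < g.Bbase
  · obtain ⟨r, j, hr, hj, rfl⟩ := exists_rowAddr (base₀ := g.Abase) (N := g.N) (a := a) hd (by omega)
      (by omega)
    exact hAA r j hr hj
  · obtain ⟨r, j, hr, hj, rfl⟩ := exists_rowAddr (base₀ := g.Bbase) (N := g.N) (a := a) hd (by omega)
      (by omega)
    exact hBB r j hr hj

/-! ### The initialisation: guards, gadget, header -/

/-- Guard column of side `A`: `r50 := N; r51 := Abase + EX; fillStride 1`. [folklore] -/
def guardA : SProg := seqs [block [(.add, r 50, r 25, im 0), (.add, r 51, r 34, r 39)], fillStride 1]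

/-- Guard column of side `B`. [folklore] -/
def guardB : SProg := seqs [block [(.add, r 50, r 25, im 0), (.add, r 51, r 35, r 39)], fillStride 1]

/-- The body of the gadget bit loop (bit `t = r65` of `i = r66` into the four gadget cells of row
`r61`, whose side bases are `r62`, `r63`). [folklore] -/
def gadgetBitBody : List OpSpec :=
  [(.shr, r 67, r 66, r 65), (.band, r 67, r 67, im 1), (.bxor, r 68, r 67, im 1),
   (.add, r 69, r 62, r 27), (.add, r 69, r 69, r 65), (.band, pt 69, r 67, r 67),
   (.add, r 69, r 69, r 23), (.band, pt 69, r 68, r 68),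
   (.add, r 69, r 63, r 27), (.add, r 69, r 69, r 65), (.band, pt 69, r 68, r 68),
   (.add, r 69, r 69, r 23), (.band, pt 69, r 67, r 67),
   (.add, r 65, r 65, im 1), (.sub, r 64, r 64, im 1)]

/-- One row of the gadget: `i := r >>> hh`, the bit loop, advance the row. [folklore] -/
def gadgetRow : SProg := seqs [
  block [(.shr, r 66, r 61, r 21), (.add, r 64, r 23, im 0), (.band, r 65, im 0, im 0)],
  whilenz (r 64) (block gadgetBitBody),
  block [(.add, r 62, r 62, r 26), (.add, r 63, r 63, r 26), (.add, r 61, r 61, im 1),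
    (.sub, r 60, r 60, im 1)]]

/-- The index gadget of all rows. [folklore] -/
def gadgetRows : SProg := seqs [
  block [(.add, r 60, r 25, im 0), (.band, r 61, im 0, im 0), (.add, r 62, r 34, im 0),
    (.add, r 63, r 35, im 0)],
  whilenz (r 60) gadgetRow]

/-- The header `|y|, N, d` of the emulated input. [folklore] -/
def header : SProg := block [(.band, pt 32, r 28, r 28), (.add, r 69, r 32, im 1),
  (.band, pt 69, r 25, r 25), (.add, r 69, r 69, im 1), (.band, pt 69, r 26, r 26)]

/-- **The initialisation phase.** [folklore] -/
def initPhase : SProg := seqs [guardA, guardB, gadgetRows, header]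

/-- The initialisation is query-free. [folklore] -/
theorem initPhase_queryFree : initPhase.QueryFree := by
  simp [initPhase, guardA, guardB, gadgetRows, gadgetRow, header, fillStride, seqs, QueryFree,
    block_queryFree]

/-! ### The intermediate memories of the initialisation -/

/-- After the guard column of side `A`. [folklore] -/
def guardAHeap : ℕ → ℕ := strideSet g.base (g.Abase + 0 * g.d + g.EX) g.d 1 g.N

/-- After both guard columns. [folklore] -/
def guardBHeap : ℕ → ℕ := strideSet g.guardAHeap (g.Bbase + 0 * g.d + g.EX) g.d 1 g.N

/-- The gadget bit of side `A` at coordinate `j ∈ [D, D + 2ℓ)` of row `r`. [folklore] -/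
def gbitA (r j : ℕ) : ℕ :=
  if j < g.D + g.ℓ then ((r / g.H).testBit (j - g.D)).toNat else (!(r / g.H).testBit (j - g.D - g.ℓ)).toNat

/-- The gadget bit of side `B`. [folklore] -/
def gbitB (r j : ℕ) : ℕ :=
  if j < g.D + g.ℓ then (!(r / g.H).testBit (j - g.D)).toNat else ((r / g.H).testBit (j - g.D - g.ℓ)).toNat

/-- Which gadget cells are written after `r` complete rows and `t` bits of row `r`. [folklore] -/
def gw (r t r' j : ℕ) : Prop :=
  (r' < r ∧ g.D ≤ j ∧ j < g.D + 2 * g.ℓ) ∨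
    (r' = r ∧ ((g.D ≤ j ∧ j < g.D + t) ∨ (g.D + g.ℓ ≤ j ∧ j < g.D + g.ℓ + t)))

/-- `gw` is decidable (it is used in an `if`). [folklore] -/
instance (r t r' j : ℕ) : Decidable (g.gw r t r' j) := by unfold gw; infer_instance

/-- The memory after `r` complete gadget rows and `t` bits of row `r`. [folklore] -/
def gadHeap (r t : ℕ) : ℕ → ℕ := fun a =>
  if g.Abase ≤ a ∧ a < g.Abase + g.Nd then
    (if g.gw r t ((a - g.Abase) / g.d) ((a - g.Abase) % g.d) then g.gbitA ((a - g.Abase) / g.d) ((a - g.Abase) % g.d)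
      else g.guardBHeap a)
  else if g.Bbase ≤ a ∧ a < g.Bbase + g.Nd then
    (if g.gw r t ((a - g.Bbase) / g.d) ((a - g.Bbase) % g.d) then g.gbitB ((a - g.Bbase) / g.d) ((a - g.Bbase) % g.d)
      else g.guardBHeap a)
  else g.guardBHeap a

/-- The final memory of the initialisation: gadget everywhere and the header. [folklore] -/
def initFinal : ℕ → ℕ :=
  Function.update (Function.update (Function.update (g.gadHeap g.N 0) g.Bv g.ylen) (g.Bv + 1) g.N)
    (g.Bv + 2) g.d

section closedForms

variable {g}

/-- The guard heaps outside the region are the frozen data. [folklore] -/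
theorem guardBHeap_of_not_region (hK : g.OK W) {a : ℕ} (ha : a < g.Bv ∨ g.rEnd ≤ a) :
    g.guardBHeap a = g.base a := by
  obtain ⟨hA, hB, hE, hNd, -, -, -, -⟩ := g.layout
  have hEX := hK.EX_lt
  unfold guardBHeap guardAHeap
  rcases ha with ha | ha
  · rw [strideSet_of_lt_base (by omega : a < g.Bbase), strideSet_of_lt_base (by omega : a < g.Abase)]
  · rw [strideSet_of_side_end_le (N := g.N) hEX (by omega) (by omega : g.Bbase + g.N * g.d ≤ a),
      strideSet_of_side_end_le (N := g.N) hEX (by omega) (by omega : g.Abase + g.N * g.d ≤ a)]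

/-- The guard heaps on side `A`. [folklore] -/
theorem guardBHeap_A (hK : g.OK W) {r j : ℕ} (hr : r < g.N) (hj : j < g.d) :
    g.guardBHeap (g.Abase + r * g.d + j) = if j = g.EX then 1 else 0 := by
  obtain ⟨hA, hB, hE, hNd, -, -, -, -⟩ := g.layout
  have hEX := hK.EX_lt
  have hlt := rowAddr_lt (base₀ := g.Abase) hr hj
  unfold guardBHeap guardAHeap
  rw [strideSet_of_lt_base (by omega : g.Abase + r * g.d + j < g.Bbase), strideSet_rowAddr hEX hj,
    hK.base_zero _ (by omega) (by omega)]
  by_cases h : j = g.EX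
  · rw [if_pos ⟨h, Nat.zero_le _, by omega⟩, if_pos h]
  · rw [if_neg (fun h' => h h'.1), if_neg h]

/-- The guard heaps on side `B`. [folklore] -/
theorem guardBHeap_B (hK : g.OK W) {r j : ℕ} (hr : r < g.N) (hj : j < g.d) :
    g.guardBHeap (g.Bbase + r * g.d + j) = if j = g.EX then 1 else 0 := by
  obtain ⟨hA, hB, hE, hNd, -, -, -, -⟩ := g.layout
  have hEX := hK.EX_lt
  have hlt := rowAddr_lt (base₀ := g.Bbase) hr hj
  unfold guardBHeap guardAHeap
  rw [strideSet_rowAddr hEX hj,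
    strideSet_of_side_end_le (N := g.N) hEX (by omega) (by omega : g.Abase + g.N * g.d ≤ g.Bbase + r * g.d + j),
    hK.base_zero _ (by omega) (by omega)]
  by_cases h : j = g.EX
  · rw [if_pos ⟨h, Nat.zero_le _, by omega⟩, if_pos h]
  · rw [if_neg (fun h' => h h'.1), if_neg h]

/-- Every cell of the guard heaps is below `2 ^ W`. [folklore] -/
theorem guardBHeap_lt (hK : g.OK W) {a : ℕ} (ha : 100 ≤ a) : g.guardBHeap a < 2 ^ W := by
  have h2 : 1 < 2 ^ W := Nat.one_lt_two_pow (by have := hK.one_le_W; omega)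
  obtain ⟨hA, hB, hE, hNd, -, -, -, -⟩ := g.layout
  by_cases h1 : a < g.Bv
  · rw [guardBHeap_of_not_region hK (Or.inl h1)]; exact hK.base_lt a ha
  by_cases h2' : g.rEnd ≤ a
  · rw [guardBHeap_of_not_region hK (Or.inr h2')]; exact hK.base_lt a ha
  by_cases h3 : a < g.Abase
  · unfold guardBHeap guardAHeap
    rw [strideSet_of_lt_base (by omega : a < g.Bbase), strideSet_of_lt_base (by omega : a < g.Abase)]
    exact hK.base_lt a ha
  by_cases h4 : a < g.Bbase
  · obtain ⟨r, j, hr, hj, rfl⟩ := exists_rowAddr (base₀ := g.Abase) (N := g.N) (a := a) hK.d_pos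
      (by omega) (by omega)
    rw [guardBHeap_A hK hr hj]; split_ifs <;> omega
  · obtain ⟨r, j, hr, hj, rfl⟩ := exists_rowAddr (base₀ := g.Bbase) (N := g.N) (a := a) hK.d_pos
      (by omega) (by omega)
    rw [guardBHeap_B hK hr hj]; split_ifs <;> omega

/-- `gadHeap` on side `A`, by row and coordinate. [folklore] -/
theorem gadHeap_A (r t : ℕ) {r' j : ℕ} (hr' : r' < g.N) (hj : j < g.d) :
    g.gadHeap r t (g.Abase + r' * g.d + j) =
      if g.gw r t r' j then g.gbitA r' j else g.guardBHeap (g.Abase + r' * g.d + j) := by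
  obtain ⟨hA, hB, hE, hNd, -, -, -, -⟩ := g.layout
  have hlt := rowAddr_lt (base₀ := g.Abase) hr' hj
  obtain ⟨h1, h2⟩ := Complexity.div_mod_block (k := r') hj
  unfold gadHeap
  rw [if_pos ⟨by omega, by rw [hNd]; omega⟩, Nat.add_assoc, Nat.add_sub_cancel_left, h1, h2]

/-- `gadHeap` on side `B`, by row and coordinate. [folklore] -/
theorem gadHeap_B (r t : ℕ) {r' j : ℕ} (hr' : r' < g.N) (hj : j < g.d) :
    g.gadHeap r t (g.Bbase + r' * g.d + j) =
      if g.gw r t r' j then g.gbitB r' j else g.guardBHeap (g.Bbase + r' * g.d + j) := by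
  obtain ⟨hA, hB, hE, hNd, -, -, -, -⟩ := g.layout
  have hlt := rowAddr_lt (base₀ := g.Bbase) hr' hj
  obtain ⟨h1, h2⟩ := Complexity.div_mod_block (k := r') hj
  unfold gadHeap
  rw [if_neg (by rw [hNd]; omega), if_pos ⟨by omega, by rw [hNd]; omega⟩, Nat.add_assoc,
    Nat.add_sub_cancel_left, h1, h2]

/-- `gadHeap` outside the region. [folklore] -/
theorem gadHeap_of_not_region (hK : g.OK W) (r t : ℕ) {a : ℕ} (ha : a < g.Bv ∨ g.rEnd ≤ a) :
    g.gadHeap r t a = g.base a := by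
  obtain ⟨hA, hB, hE, hNd, -, -, -, -⟩ := g.layout
  unfold gadHeap
  rw [if_neg (by omega), if_neg (by omega), guardBHeap_of_not_region hK ha]

/-- `gadHeap` on the header cells. [folklore] -/
theorem gadHeap_header (r t : ℕ) {a : ℕ} (ha : g.Bv ≤ a) (ha' : a < g.Abase) :
    g.gadHeap r t a = g.guardBHeap a := by
  obtain ⟨hA, hB, hE, hNd, -, -, -, -⟩ := g.layout
  unfold gadHeap
  rw [if_neg (by omega), if_neg (by omega)]

/-- Gadget bits are bits. [folklore] -/
theorem gbitA_le (r j : ℕ) : g.gbitA r j ≤ 1 := by unfold gbitA; split_ifs <;> exact Bool.toNat_le _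
/-- Gadget bits are bits. [folklore] -/
theorem gbitB_le (r j : ℕ) : g.gbitB r j ≤ 1 := by unfold gbitB; split_ifs <;> exact Bool.toNat_le _

/-- Every cell of `gadHeap` is below `2 ^ W`. [folklore] -/
theorem gadHeap_lt (hK : g.OK W) (r t : ℕ) {a : ℕ} (ha : 100 ≤ a) : g.gadHeap r t a < 2 ^ W := by
  have h2 : 1 < 2 ^ W := Nat.one_lt_two_pow (by have := hK.one_le_W; omega)
  have hg := guardBHeap_lt hK ha
  unfold gadHeap
  split_ifs
  · exact lt_of_le_of_lt (g.gbitA_le _ _) h2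
  · exact hg
  · exact lt_of_le_of_lt (g.gbitB_le _ _) h2
  · exact hg
  · exact hg

/-- Completing the bits of row `r` is starting row `r + 1`. [folklore] -/
theorem gw_row_done (r r' j : ℕ) : g.gw r g.ℓ r' j ↔ g.gw (r + 1) 0 r' j := by
  unfold gw; omega

/-- One more bit of row `r`: exactly the two cells `(r, D + t)` and `(r, D + ℓ + t)` are added. [folklore] -/
theorem gw_succ (r t r' j : ℕ) (ht : t < g.ℓ) :
    g.gw r (t + 1) r' j ↔ g.gw r t r' j ∨ (r' = r ∧ (j = g.D + t ∨ j = g.D + g.ℓ + t)) := by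
  unfold gw; omega

/-- The row-completion step does not change the heap. [folklore] -/
theorem gadHeap_row_done (r : ℕ) : g.gadHeap r g.ℓ = g.gadHeap (r + 1) 0 := by
  funext a
  unfold gadHeap
  simp only [gw_row_done]

/-- **The final memory of the initialisation is the intended memory of the empty disjunction.**
[folklore] -/
theorem initFinal_eq_bheap (hK : g.OK W) : ∀ a, 100 ≤ a → g.initFinal a = g.bheap [] [] a := by
  obtain ⟨hA, hB, hE, hNd, -, -, hEXe, -⟩ := g.layout
  have hEX := hK.EX_lt
  have hd := hK.d_pos
  refine g.data_ext hd ⟨?_, ?_, ?_⟩ (fun r j hr hj => ?_) (fun r j hr hj => ?_) (fun a ha hout => ?_)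
  · unfold initFinal bheap
    rw [Function.update_of_ne (by omega), Function.update_of_ne (by omega), Function.update_self,
      if_pos rfl]
  · unfold initFinal bheap
    rw [Function.update_of_ne (by omega), Function.update_self, if_neg (by omega), if_pos rfl]
  · unfold initFinal bheap
    rw [Function.update_self, if_neg (by omega), if_neg (by omega), if_pos rfl]
  · have hlt := rowAddr_lt (base₀ := g.Abase) hr hj
    unfold initFinal
    rw [Function.update_of_ne (by omega), Function.update_of_ne (by omega),
      Function.update_of_ne (by omega), gadHeap_A _ _ hr hj, bheap_A _ _ _ hr hj, uCoord_nil,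
      guardBHeap_A hK hr hj]
    unfold gw gbitA
    rw [hEXe]
    split_ifs <;> first | rfl | omega
  · have hlt := rowAddr_lt (base₀ := g.Bbase) hr hj
    unfold initFinal
    rw [Function.update_of_ne (by omega), Function.update_of_ne (by omega),
      Function.update_of_ne (by omega), gadHeap_B _ _ hr hj, bheap_B _ _ _ hr hj, vCoord_nil,
      guardBHeap_B hK hr hj]
    unfold gw gbitB
    rw [hEXe]
    split_ifs <;> first | rfl | omega
  · unfold initFinal
    rw [Function.update_of_ne (by omega), Function.update_of_ne (by omega),
      Function.update_of_ne (by omega), gadHeap_of_not_region hK _ _ hout, bheap_of_not_region _ _ _ hout]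

end closedForms

/-! ### Congruence of the generic closed forms in the data -/

/-- Update towers over functions that agree at a point agree at that point. [folklore] -/
theorem update_apply_congr {f f' : ℕ → ℕ} {a : ℕ} (h : f a = f' a) (b v : ℕ) :
    Function.update f b v a = Function.update f' b v a := by
  by_cases hab : a = b
  · subst hab; rw [Function.update_self, Function.update_self]
  · rw [Function.update_of_ne hab, Function.update_of_ne hab, h]

/-- `strideSet` above `100` only depends on the memory above `100` (for a start `≥ 100`). [folklore] -/
theorem strideSet_congr_data {m₁ m₂ : ℕ → ℕ} {a₀ d v : ℕ} (ha₀ : 100 ≤ a₀)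
    (h : ∀ a, 100 ≤ a → m₁ a = m₂ a) : ∀ (cnt a : ℕ), 100 ≤ a →
    strideSet m₁ a₀ d v cnt a = strideSet m₂ a₀ d v cnt a
  | 0, a, ha => h a ha
  | cnt + 1, a, ha => by
    simp only [strideSet]
    by_cases hx : a = a₀ + cnt * d
    · subst hx; rw [Function.update_self, Function.update_self]
    · rw [Function.update_of_ne hx, Function.update_of_ne hx, strideSet_congr_data ha₀ h cnt a ha]

/-- `strideAnd` above `100` only depends on the memory above `100` (for a start `≥ 100`). [folklore] -/
theorem strideAnd_congr_data {m₁ m₂ : ℕ → ℕ} {a₀ d pos : ℕ} {b : Bool} (ha₀ : 100 ≤ a₀)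
    (h : ∀ a, 100 ≤ a → m₁ a = m₂ a) : ∀ (cnt a : ℕ), 100 ≤ a →
    strideAnd m₁ a₀ d pos b cnt a = strideAnd m₂ a₀ d pos b cnt a
  | 0, a, ha => h a ha
  | cnt + 1, a, ha => by
    simp only [strideAnd]
    by_cases hx : a = a₀ + cnt * d
    · subst hx
      rw [Function.update_self, Function.update_self, strideAnd_congr_data ha₀ h cnt _ ha]
    · rw [Function.update_of_ne hx, Function.update_of_ne hx, strideAnd_congr_data ha₀ h cnt a ha]

/-! ### Numeric consequences of the side conditions -/

/-- The frequently used numeric facts of a build. [folklore] -/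
theorem facts (hK : g.OK W) :
    100 ≤ g.Bv ∧ g.Abase = g.Bv + 3 ∧ g.Bbase = g.Abase + g.Nd ∧ g.rEnd = g.Bbase + g.Nd ∧
    g.Nd = g.N * g.d ∧ g.Hd = g.H * g.d ∧ g.ylen = 2 + 2 * g.Nd ∧ g.EX = g.D + 2 * g.ℓ ∧
    g.rEnd + g.d ≤ g.Qtm ∧ g.Qtm + g.κ + g.i₁ = g.bot ∧ g.bot + g.κ * g.len < 2 ^ W ∧ g.EX < g.d ∧
    0 < g.d ∧ 1 < 2 ^ W ∧ g.N ≤ g.Nd ∧ g.d ≤ g.Nd ∧ g.rEnd + g.d < 2 ^ W := by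
  obtain ⟨hA, hB, hE, hNd, hHd, hy, hEX, hbot⟩ := g.layout
  have h1 : g.N ≤ g.Nd := by rw [hNd]; exact Nat.le_mul_of_pos_right _ hK.d_pos
  have h2 : g.d ≤ g.Nd := by rw [hNd]; exact Nat.le_mul_of_pos_left _ hK.N_pos
  have h3 := hK.region_le; have h4 := hK.top_lt
  refine ⟨hK.Bv_ge, hA, hB, hE, hNd, hHd, hy, hEX, hK.region_le, hbot.symm, hK.top_lt, hK.EX_lt,
    hK.d_pos, Nat.one_lt_two_pow (by have := hK.one_le_W; omega), h1, h2, by omega⟩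

/-! ### Certificates of the initialisation -/

section initSpecs

variable {O : List ℕ → List ℕ}

/-- The time of the initialisation phase. [folklore] -/
def Tinit : ℕ := g.N * (17 * g.ℓ + 20) + 16

set_option linter.unusedSimpArgs false in
/-- **Guard column of side `A`.** [folklore] -/
theorem guardA_spec (hK : g.OK W) {m : ℕ → ℕ} (hR : g.BRegs m) (hD : ∀ a, 100 ≤ a → m a = g.base a) :
    Achieves W O guardA m (fun m' => g.BRegs m' ∧ ∀ a, 100 ≤ a → m' a = g.guardAHeap a)
      (2 + (g.N * 5 + 1)) := by
  obtain ⟨hBv, hA, hB, hE, hNd, hHd, hy, hEXe, hQ, hbot, htop, hEX, hd, h1W, hNNd, hdNd, hRW⟩ := g.facts hK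
  obtain ⟨r20, r21, r22, r23, r25, r26, r27, r28, r32, r34, r35, r36, r38, r39⟩ := hR
  unfold guardA
  refine Achieves.seqs_cons (R := fun m₁ => m₁ 50 = g.N ∧ m₁ 51 = g.Abase + g.EX ∧ m₁ 26 = g.d ∧
      (∀ i, i < 100 → i ≠ 50 → i ≠ 51 → m₁ i = m i) ∧ ∀ a, 100 ≤ a → m₁ a = g.base a) ?_ ?_
  · refine achieves_block_of_eq (fun m' hm' => ?_) le_rfl
    simp (disch := omega) only [execOps_cons, execOps_nil, execOp, Operand.write,
      Operand.read, merge_apply_of_lt, update_merge_of_lt, Function.update_self,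
      Function.update_of_ne, BinOp.eval_add_of_lt, Nat.add_zero, r25, r34, r39] at hm'
    subst hm'
    refine ⟨?_, ?_, ?_, fun i hi h50 h51 => ?_, fun a ha => ?_⟩
    · simp (disch := omega) only [merge_apply_of_lt, Function.update_self,
        Function.update_of_ne]
    · simp (disch := omega) only [merge_apply_of_lt, Function.update_self,
        Function.update_of_ne]
    · simp (disch := omega) only [merge_apply_of_lt, Function.update_self,
        Function.update_of_ne, r26]
    · rw [merge_apply_of_lt hi]; simp (disch := omega) only [Function.update_of_ne]
    · rw [merge_apply_of_le ha, hD a ha]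
  · intro m₁ ⟨h50, h51, h26, hfr, hD₁⟩
    have hfit : g.Abase + g.EX + g.N * g.d < 2 ^ W := by omega
    have hNW : g.N < 2 ^ W := by omega
    refine Achieves.seqs_cons (T₂ := 0) (fillStride_spec (m := m₁) (cnt := g.N) (a₀ := g.Abase + g.EX)
      (d := g.d) (v := 1) h50 h51 h26 (by omega) hfit hNW)
      fun m₂ ⟨_, _, hfr₂, hD₂⟩ => Achieves.seqs_nil ⟨?_, fun a ha => ?_⟩
    · exact BRegs.of_frame ⟨r20, r21, r22, r23, r25, r26, r27, r28, r32, r34, r35, r36, r38, r39⟩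
        fun i hi1 hi2 => by rw [hfr₂ i (by omega) (by omega) (by omega), hfr i (by omega) (by omega) (by omega)]
    · rw [hD₂ a ha, strideSet_congr_data (by omega) hD₁ _ _ ha]
      show _ = strideSet g.base (g.Abase + 0 * g.d + g.EX) g.d 1 g.N a
      rw [Nat.zero_mul, Nat.add_zero]

set_option linter.unusedSimpArgs false in
/-- **Guard column of side `B`.** [folklore] -/
theorem guardB_spec (hK : g.OK W) {m : ℕ → ℕ} (hR : g.BRegs m)
    (hD : ∀ a, 100 ≤ a → m a = g.guardAHeap a) :
    Achieves W O guardB m (fun m' => g.BRegs m' ∧ ∀ a, 100 ≤ a → m' a = g.guardBHeap a)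
      (2 + (g.N * 5 + 1)) := by
  obtain ⟨hBv, hA, hB, hE, hNd, hHd, hy, hEXe, hQ, hbot, htop, hEX, hd, h1W, hNNd, hdNd, hRW⟩ := g.facts hK
  obtain ⟨r20, r21, r22, r23, r25, r26, r27, r28, r32, r34, r35, r36, r38, r39⟩ := hR
  unfold guardB
  refine Achieves.seqs_cons (R := fun m₁ => m₁ 50 = g.N ∧ m₁ 51 = g.Bbase + g.EX ∧ m₁ 26 = g.d ∧
      (∀ i, i < 100 → i ≠ 50 → i ≠ 51 → m₁ i = m i) ∧ ∀ a, 100 ≤ a → m₁ a = g.guardAHeap a) ?_ ?_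
  · refine achieves_block_of_eq (fun m' hm' => ?_) le_rfl
    simp (disch := omega) only [execOps_cons, execOps_nil, execOp, Operand.write,
      Operand.read, merge_apply_of_lt, update_merge_of_lt, Function.update_self,
      Function.update_of_ne, BinOp.eval_add_of_lt, Nat.add_zero, r25, r35, r39] at hm'
    subst hm'
    refine ⟨?_, ?_, ?_, fun i hi h50 h51 => ?_, fun a ha => ?_⟩
    · simp (disch := omega) only [merge_apply_of_lt, Function.update_self,
        Function.update_of_ne]
    · simp (disch := omega) only [merge_apply_of_lt, Function.update_self,
        Function.update_of_ne]
    · simp (disch := omega) only [merge_apply_of_lt, Function.update_self,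
        Function.update_of_ne, r26]
    · rw [merge_apply_of_lt hi]; simp (disch := omega) only [Function.update_of_ne]
    · rw [merge_apply_of_le ha, hD a ha]
  · intro m₁ ⟨h50, h51, h26, hfr, hD₁⟩
    have hfit : g.Bbase + g.EX + g.N * g.d < 2 ^ W := by omega
    have hNW : g.N < 2 ^ W := by omega
    refine Achieves.seqs_cons (T₂ := 0) (fillStride_spec (m := m₁) (cnt := g.N) (a₀ := g.Bbase + g.EX)
      (d := g.d) (v := 1) h50 h51 h26 (by omega) hfit hNW)
      fun m₂ ⟨_, _, hfr₂, hD₂⟩ => Achieves.seqs_nil ⟨?_, fun a ha => ?_⟩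
    · exact BRegs.of_frame ⟨r20, r21, r22, r23, r25, r26, r27, r28, r32, r34, r35, r36, r38, r39⟩
        fun i hi1 hi2 => by rw [hfr₂ i (by omega) (by omega) (by omega), hfr i (by omega) (by omega) (by omega)]
    · rw [hD₂ a ha, strideSet_congr_data (by omega) hD₁ _ _ ha]
      show _ = strideSet g.guardAHeap (g.Bbase + 0 * g.d + g.EX) g.d 1 g.N a
      rw [Nat.zero_mul, Nat.add_zero]

/-- **One more gadget bit, as four cell updates** (in the order the program performs them).
[folklore] -/
theorem gadHeap_succ (hK : g.OK W) {r t : ℕ} (hr : r < g.N) (ht : t < g.ℓ) :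
    ∀ a, 100 ≤ a →
      Function.update (Function.update (Function.update (Function.update (g.gadHeap r t)
        (g.Abase + r * g.d + (g.D + t)) (((r / g.H).testBit t).toNat))
        (g.Abase + r * g.d + (g.D + g.ℓ + t)) ((!(r / g.H).testBit t).toNat))
        (g.Bbase + r * g.d + (g.D + t)) ((!(r / g.H).testBit t).toNat))
        (g.Bbase + r * g.d + (g.D + g.ℓ + t)) (((r / g.H).testBit t).toNat) a =
      g.gadHeap r (t + 1) a := by
  obtain ⟨hBv, hA, hB, hE, hNd, hHd, hy, hEXe, hQ, hbot, htop, hEX, hd, h1W, hNNd, hdNd, hRW⟩ := g.facts hK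
  have hj1 : g.D + t < g.d := by omega
  have hj2 : g.D + g.ℓ + t < g.d := by omega
  refine g.data_ext hd ⟨?_, ?_, ?_⟩ (fun r' j hr' hj => ?_) (fun r' j hr' hj => ?_) (fun a ha hout => ?_)
  · have h4 := rowAddr_lt (base₀ := g.Abase) hr hj1
    simp (disch := omega) only [Function.update_of_ne]
    rw [gadHeap_header _ _ (le_refl g.Bv) (by omega : g.Bv < g.Abase),
      gadHeap_header _ _ (le_refl g.Bv) (by omega : g.Bv < g.Abase)]
  · have h4 := rowAddr_lt (base₀ := g.Abase) hr hj1
    simp (disch := omega) only [Function.update_of_ne]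
    rw [gadHeap_header _ _ (by omega : g.Bv ≤ g.Bv + 1) (by omega : g.Bv + 1 < g.Abase),
      gadHeap_header _ _ (by omega : g.Bv ≤ g.Bv + 1) (by omega : g.Bv + 1 < g.Abase)]
  · have h4 := rowAddr_lt (base₀ := g.Abase) hr hj1
    simp (disch := omega) only [Function.update_of_ne]
    rw [gadHeap_header _ _ (by omega : g.Bv ≤ g.Bv + 2) (by omega : g.Bv + 2 < g.Abase),
      gadHeap_header _ _ (by omega : g.Bv ≤ g.Bv + 2) (by omega : g.Bv + 2 < g.Abase)]
  · -- side A
    have hlt := rowAddr_lt (base₀ := g.Abase) hr' hj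
    rw [Function.update_of_ne (by omega), Function.update_of_ne (by omega)]
    rw [gadHeap_A _ _ hr' hj]
    simp only [g.gw_succ _ _ _ _ ht]
    by_cases hc2 : r' = r ∧ j = g.D + g.ℓ + t
    · obtain ⟨rfl, rfl⟩ := hc2
      rw [Function.update_self, if_pos (Or.inr ⟨rfl, Or.inr rfl⟩)]
      unfold gbitA; rw [if_neg (by omega), show g.D + g.ℓ + t - g.D - g.ℓ = t by omega]
    rw [Function.update_of_ne (fun h => hc2 (rowAddr_inj hj hj2 h))]
    by_cases hc1 : r' = r ∧ j = g.D + t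
    · obtain ⟨rfl, rfl⟩ := hc1
      rw [Function.update_self, if_pos (Or.inr ⟨rfl, Or.inl rfl⟩)]
      unfold gbitA; rw [if_pos (by omega), show g.D + t - g.D = t by omega]
    rw [Function.update_of_ne (fun h => hc1 (rowAddr_inj hj hj1 h)), gadHeap_A _ _ hr' hj]
    have : ¬ (r' = r ∧ (j = g.D + t ∨ j = g.D + g.ℓ + t)) := fun ⟨h1, h2⟩ =>
      h2.elim (fun h => hc1 ⟨h1, h⟩) (fun h => hc2 ⟨h1, h⟩)
    simp only [this, or_false]
  · -- side B
    have hlt := rowAddr_lt (base₀ := g.Bbase) hr' hj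
    have h4 := rowAddr_lt (base₀ := g.Abase) hr hj2
    have h5 := rowAddr_lt (base₀ := g.Abase) hr hj1
    rw [gadHeap_B _ _ hr' hj]
    simp only [g.gw_succ _ _ _ _ ht]
    by_cases hc2 : r' = r ∧ j = g.D + g.ℓ + t
    · obtain ⟨rfl, rfl⟩ := hc2
      rw [Function.update_self, if_pos (Or.inr ⟨rfl, Or.inr rfl⟩)]
      unfold gbitB; rw [if_neg (by omega), show g.D + g.ℓ + t - g.D - g.ℓ = t by omega]
    rw [Function.update_of_ne (fun h => hc2 (rowAddr_inj hj hj2 h))]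
    by_cases hc1 : r' = r ∧ j = g.D + t
    · obtain ⟨rfl, rfl⟩ := hc1
      rw [Function.update_self, if_pos (Or.inr ⟨rfl, Or.inl rfl⟩)]
      unfold gbitB; rw [if_pos (by omega), show g.D + t - g.D = t by omega]
    rw [Function.update_of_ne (fun h => hc1 (rowAddr_inj hj hj1 h)), Function.update_of_ne (by omega),
      Function.update_of_ne (by omega), gadHeap_B _ _ hr' hj]
    have : ¬ (r' = r ∧ (j = g.D + t ∨ j = g.D + g.ℓ + t)) := fun ⟨h1, h2⟩ =>
      h2.elim (fun h => hc1 ⟨h1, h⟩) (fun h => hc2 ⟨h1, h⟩)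
    simp only [this, or_false]
  · have h4 := rowAddr_lt (base₀ := g.Abase) hr hj1
    have h5 := rowAddr_lt (base₀ := g.Bbase) hr hj2
    simp (disch := omega) only [Function.update_of_ne]
    rw [gadHeap_of_not_region hK _ _ hout, gadHeap_of_not_region hK _ _ hout]

/-- The invariant of the gadget bit loop of row `r` after `t` bits. [folklore] -/
def GadInv (r : ℕ) (m₀ : ℕ → ℕ) (t : ℕ) (m : ℕ → ℕ) : Prop :=
  m 64 = g.ℓ - t ∧ m 65 = t ∧ m 66 = r / g.H ∧ m 62 = g.Abase + r * g.d ∧ m 63 = g.Bbase + r * g.d ∧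
    m 60 = m₀ 60 ∧ m 61 = m₀ 61 ∧ g.BRegs m ∧ (∀ i, i < 60 → m i = m₀ i) ∧
    ∀ a, 100 ≤ a → m a = g.gadHeap r t a

set_option linter.unusedSimpArgs false in
/-- **One iteration of the gadget bit loop.** [folklore] -/
theorem gadgetBitBody_spec (hK : g.OK W) {r : ℕ} (hr : r < g.N) {m₀ m : ℕ → ℕ} {t : ℕ} (ht : t < g.ℓ)
    (hI : g.GadInv r m₀ t m) : Achieves W O (block gadgetBitBody) m (g.GadInv r m₀ (t + 1)) 15 := by
  obtain ⟨hBv, hA, hB, hE, hNd, -, -, hEXe, -, -, -, hEX, hd, h1W, -, hdNd, hRW⟩ := g.facts hK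
  have hrow := rowAddr_lt (base₀ := g.Bbase) hr hEX
  obtain ⟨h64, h65, h66, h62, h63, h60, h61, hR, hlow, hDat⟩ := hI
  have r23 := hR.r23; have r27 := hR.r27
  have hbit : (r / g.H) >>> t &&& 1 = ((r / g.H).testBit t).toNat := by
    rw [Nat.and_one_is_mod, Nat.shiftRight_eq_div_pow, Nat.testBit_eq_decide_div_mod_eq]
    rcases Nat.mod_two_eq_zero_or_one (r / g.H / 2 ^ t) with h0 | h1
    · rw [h0]; simp
    · rw [h1]; simp
  have hb1 : ((r / g.H).testBit t).toNat ≤ 1 := Bool.toNat_le _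
  have hnb : ((r / g.H).testBit t).toNat ^^^ 1 = (!(r / g.H).testBit t).toNat := by
    cases (r / g.H).testBit t <;> rfl
  have hnb1 : (!(r / g.H).testBit t).toNat ≤ 1 := Bool.toNat_le _
  refine achieves_block_of_eq (fun m'' hm'' => ?_) le_rfl
  unfold gadgetBitBody at hm''
  simp (disch := omega) only [execOps_cons, execOps_nil, execOp, Operand.write,
    Operand.read, merge_apply_of_lt, merge_apply_of_le, update_merge_of_lt, update_merge_of_le,
    Function.update_self, Function.update_of_ne, BinOp.eval_add_of_lt, BinOp.eval_sub_of_le,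
    BinOp.eval_band, BinOp.eval_shr, Nat.and_self, h64, h65, h66, h62, h63, r23, r27, hbit] at hm''
  rw [BinOp.eval_bxor_of_lt (by omega) (by omega), hnb] at hm''
  subst hm''
  refine ⟨?_, ?_, ?_, ?_, ?_, ?_, ?_, ?_, fun i hi => ?_, fun a ha => ?_⟩
  · simp (disch := omega) only [merge_apply_of_lt, Function.update_self, Function.update_of_ne]; omega
  · simp (disch := omega) only [merge_apply_of_lt, Function.update_self, Function.update_of_ne]
  · simp (disch := omega) only [merge_apply_of_lt, Function.update_self, Function.update_of_ne, h66]
  · simp (disch := omega) only [merge_apply_of_lt, Function.update_self, Function.update_of_ne, h62]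
  · simp (disch := omega) only [merge_apply_of_lt, Function.update_self, Function.update_of_ne, h63]
  · simp (disch := omega) only [merge_apply_of_lt, Function.update_self, Function.update_of_ne, h60]
  · simp (disch := omega) only [merge_apply_of_lt, Function.update_self, Function.update_of_ne, h61]
  · exact hR.of_frame fun i hi1 hi2 => by
      rw [merge_apply_of_lt (by omega)]; simp (disch := omega) only [Function.update_of_ne]
  · rw [merge_apply_of_lt (by omega)]; simp (disch := omega) only [Function.update_of_ne]
    exact hlow i hi
  · rw [merge_apply_of_le ha]
    have key := g.gadHeap_succ hK hr ht a ha
    rw [update_apply_congr (update_apply_congr (update_apply_congr (update_apply_congr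
      (hDat a ha).symm _ _) _ _) _ _) _ _] at key
    simpa only [Nat.add_assoc, Nat.add_comm t g.ℓ] using key

/-- **The gadget bit loop of one row.** [folklore] -/
theorem gadgetBits_spec (hK : g.OK W) {r : ℕ} (hr : r < g.N) {m₀ m : ℕ → ℕ} (hI : g.GadInv r m₀ 0 m) :
    Achieves W O (whilenz (OVRed.r 64) (block gadgetBitBody)) m (g.GadInv r m₀ g.ℓ)
      (g.ℓ * (15 + 2) + 1) := by
  refine Achieves.whilenz g.ℓ 15 (g.GadInv r m₀) (fun t ht m' hI' => ⟨?_, ?_⟩) (fun m' hI' => ?_) hI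
    (fun m' h => h) le_rfl
  · obtain ⟨h64, -⟩ := hI'
    simp only [Operand.read, h64]; omega
  · exact g.gadgetBitBody_spec hK hr ht hI'
  · obtain ⟨h64, -⟩ := hI'
    simp only [Operand.read, h64]; omega

/-- The invariant of the row loop of the gadget after `r` rows. [folklore] -/
def RowInv (m₀ : ℕ → ℕ) (r : ℕ) (m : ℕ → ℕ) : Prop :=
  m 60 = g.N - r ∧ m 61 = r ∧ m 62 = g.Abase + r * g.d ∧ m 63 = g.Bbase + r * g.d ∧ g.BRegs m ∧
    (∀ i, i < 60 → m i = m₀ i) ∧ ∀ a, 100 ≤ a → m a = g.gadHeap r 0 a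

set_option linter.unusedSimpArgs false in
/-- **One row of the gadget.** [folklore] -/
theorem gadgetRow_spec (hK : g.OK W) {m₀ m : ℕ → ℕ} {r : ℕ} (hr : r < g.N) (hI : g.RowInv m₀ r m) :
    Achieves W O gadgetRow m (g.RowInv m₀ (r + 1)) (3 + (g.ℓ * (15 + 2) + 1) + 4) := by
  obtain ⟨hBv, hA, hB, hE, hNd, -, -, hEXe, -, -, -, hEX, hd, h1W, hNNd, hdNd, hRW⟩ := g.facts hK
  have hrow := rowAddr_lt (base₀ := g.Bbase) hr hEX
  obtain ⟨h60, h61, h62, h63, hR, hlow, hDat⟩ := hI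
  suffices main : Achieves W O gadgetRow m (g.RowInv m₀ (r + 1)) (3 + ((g.ℓ * (15 + 2) + 1) + (4 + 0))) from
    main.mono (fun _ h => h) (by omega)
  unfold gadgetRow
  -- 1. `i := r >>> hh`, the bit counter
  refine Achieves.seqs_cons (R := g.GadInv r m 0) (T₁ := 3) ?_ ?_
  · refine achieves_block_of_eq (fun m' hm' => ?_) le_rfl
    simp (disch := omega) only [execOps_cons, execOps_nil, execOp, Operand.write,
      Operand.read, merge_apply_of_lt, update_merge_of_lt, Function.update_self, Function.update_of_ne,
      BinOp.eval_add_of_lt, BinOp.eval_band, BinOp.eval_shr, Nat.and_self, Nat.add_zero, h61, hR.r21,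
      hR.r23] at hm'
    subst hm'
    refine ⟨?_, ?_, ?_, ?_, ?_, ?_, ?_, ?_, fun i hi => ?_, fun a ha => ?_⟩
    · simp (disch := omega) only [merge_apply_of_lt, Function.update_self, Function.update_of_ne, Nat.sub_zero]
    · simp (disch := omega) only [merge_apply_of_lt, Function.update_self, Function.update_of_ne]
    · simp (disch := omega) only [merge_apply_of_lt, Function.update_self, Function.update_of_ne,
        Nat.shiftRight_eq_div_pow, hK.H_eq]
    · simp (disch := omega) only [merge_apply_of_lt, Function.update_self, Function.update_of_ne, h62]
    · simp (disch := omega) only [merge_apply_of_lt, Function.update_self, Function.update_of_ne, h63]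
    · simp (disch := omega) only [merge_apply_of_lt, Function.update_self, Function.update_of_ne]
    · simp (disch := omega) only [merge_apply_of_lt, Function.update_self, Function.update_of_ne]
    · exact hR.of_frame fun i hi1 hi2 => by
        rw [merge_apply_of_lt (by omega)]; simp (disch := omega) only [Function.update_of_ne]
    · rw [merge_apply_of_lt (by omega)]; simp (disch := omega) only [Function.update_of_ne]
    · rw [merge_apply_of_le ha, hDat a ha]
  intro m₁ hI₁
  -- 2. the bit loop
  refine Achieves.seqs_cons (g.gadgetBits_spec hK hr hI₁) fun m₂ hI₂ => ?_
  obtain ⟨h64, h65, h66, h62', h63', h60', h61', hR₂, hlow₂, hDat₂⟩ := hI₂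
  -- 3. advance the row
  refine Achieves.seqs_cons (T₂ := 0) ?_ fun m₃ h => Achieves.seqs_nil h
  refine achieves_block_of_eq (fun m₃ hm₃ => ?_) le_rfl
  have hrd : g.Abase + r * g.d + g.d ≤ g.Abase + g.N * g.d := by
    have : (r + 1) * g.d ≤ g.N * g.d := Nat.mul_le_mul_right _ hr
    rw [Nat.add_mul, Nat.one_mul] at this; omega
  simp (disch := omega) only [execOps_cons, execOps_nil, execOp, Operand.write,
    Operand.read, merge_apply_of_lt, update_merge_of_lt, Function.update_self, Function.update_of_ne,
    BinOp.eval_add_of_lt, BinOp.eval_sub_of_le, h62', h63', h60', h61', h60, h61, hR₂.r26] at hm₃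
  subst hm₃
  refine ⟨?_, ?_, ?_, ?_, ?_, fun i hi => ?_, fun a ha => ?_⟩
  · simp (disch := omega) only [merge_apply_of_lt, Function.update_self, Function.update_of_ne]; omega
  · simp (disch := omega) only [merge_apply_of_lt, Function.update_self, Function.update_of_ne]
  · simp (disch := omega) only [merge_apply_of_lt, Function.update_self, Function.update_of_ne]
    rw [Nat.add_mul, Nat.one_mul, Nat.add_assoc]
  · simp (disch := omega) only [merge_apply_of_lt, Function.update_self, Function.update_of_ne]
    rw [Nat.add_mul, Nat.one_mul, Nat.add_assoc]
  · exact hR₂.of_frame fun i hi1 hi2 => by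
      rw [merge_apply_of_lt (by omega)]; simp (disch := omega) only [Function.update_of_ne]
  · rw [merge_apply_of_lt (by omega)]; simp (disch := omega) only [Function.update_of_ne]
    rw [hlow₂ i hi, hlow i hi]
  · rw [merge_apply_of_le ha, hDat₂ a ha, gadHeap_row_done]

set_option linter.unusedSimpArgs false in
/-- **The index gadget of all rows.** [folklore] -/
theorem gadgetRows_spec (hK : g.OK W) {m : ℕ → ℕ} (hR : g.BRegs m) (hD : ∀ a, 100 ≤ a → m a = g.guardBHeap a) :
    Achieves W O gadgetRows m (fun m' => g.BRegs m' ∧ ∀ a, 100 ≤ a → m' a = g.gadHeap g.N 0 a)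
      (4 + (g.N * ((3 + (g.ℓ * (15 + 2) + 1) + 4) + 2) + 1)) := by
  obtain ⟨hBv, hA, hB, hE, hNd, -, -, hEXe, -, -, -, hEX, hd, h1W, hNNd, hdNd, hRW⟩ := g.facts hK
  have hgw0 : ∀ r' j, ¬ g.gw 0 0 r' j := fun r' j h => by unfold gw at h; omega
  have hgad0 : ∀ a, g.gadHeap 0 0 a = g.guardBHeap a := fun a => by
    unfold gadHeap; simp [hgw0]
  unfold gadgetRows
  refine Achieves.seqs_cons (R := fun m₁ => g.RowInv m₁ 0 m₁) (T₁ := 4) ?_ ?_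
  · refine achieves_block_of_eq (fun m₁ hm₁ => ?_) le_rfl
    simp (disch := omega) only [execOps_cons, execOps_nil, execOp, Operand.write,
      Operand.read, merge_apply_of_lt, update_merge_of_lt, Function.update_self, Function.update_of_ne,
      BinOp.eval_add_of_lt, BinOp.eval_band, Nat.and_self, Nat.add_zero, hR.r25, hR.r34, hR.r35] at hm₁
    subst hm₁
    refine ⟨?_, ?_, ?_, ?_, ?_, fun i _ => rfl, fun a ha => ?_⟩
    · simp (disch := omega) only [merge_apply_of_lt, Function.update_self, Function.update_of_ne, Nat.sub_zero]
    · simp (disch := omega) only [merge_apply_of_lt, Function.update_self, Function.update_of_ne]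
    · simp (disch := omega) only [merge_apply_of_lt, Function.update_self, Function.update_of_ne,
        Nat.zero_mul, Nat.add_zero]
    · simp (disch := omega) only [merge_apply_of_lt, Function.update_self, Function.update_of_ne,
        Nat.zero_mul, Nat.add_zero]
    · exact hR.of_frame fun i hi1 hi2 => by
        rw [merge_apply_of_lt (by omega)]; simp (disch := omega) only [Function.update_of_ne]
    · rw [merge_apply_of_le ha, hgad0, hD a ha]
  intro m₁ hI₁
  refine Achieves.seqs_cons (T₂ := 0) ?_ fun m' h => Achieves.seqs_nil h
  refine Achieves.whilenz g.N (3 + (g.ℓ * (15 + 2) + 1) + 4) (g.RowInv m₁)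
    (fun r hr m' hI' => ⟨?_, g.gadgetRow_spec hK hr hI'⟩) (fun m' hI' => ?_) hI₁
    (fun m' ⟨_, _, _, _, hR', _, hDat'⟩ => ⟨hR', hDat'⟩) le_rfl
  · obtain ⟨h60, -⟩ := hI'
    simp only [Operand.read, h60]; omega
  · obtain ⟨h60, -⟩ := hI'
    simp only [Operand.read, h60]; omega

set_option linter.unusedSimpArgs false in
/-- **The header.** [folklore] -/
theorem header_spec (hK : g.OK W) {m : ℕ → ℕ} (hR : g.BRegs m) (hD : ∀ a, 100 ≤ a → m a = g.gadHeap g.N 0 a) :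
    Achieves W O header m (fun m' => g.BRegs m' ∧ ∀ a, 100 ≤ a → m' a = g.bheap [] [] a) 5 := by
  obtain ⟨hBv, hA, hB, hE, hNd, -, hy, hEXe, -, -, -, hEX, hd, h1W, hNNd, hdNd, hRW⟩ := g.facts hK
  unfold header
  refine achieves_block_of_eq (fun m' hm' => ?_) le_rfl
  simp (disch := omega) only [execOps_cons, execOps_nil, execOp, Operand.write,
    Operand.read, merge_apply_of_lt, update_merge_of_lt, update_merge_of_le, Function.update_self,
    Function.update_of_ne, BinOp.eval_add_of_lt, BinOp.eval_band, Nat.and_self, hR.r32, hR.r28, hR.r25,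
    hR.r26] at hm'
  subst hm'
  refine ⟨hR.of_frame fun i hi1 hi2 => by
      rw [merge_apply_of_lt (by omega)]; simp (disch := omega) only [Function.update_of_ne], fun a ha => ?_⟩
  rw [merge_apply_of_le ha, ← g.initFinal_eq_bheap hK a ha]
  unfold initFinal
  exact update_apply_congr (update_apply_congr (update_apply_congr (hD a ha) _ _) _ _) _ _

/-- **The initialisation phase.** From the constant registers and the frozen data, `initPhase`
reaches the intended memory of the empty disjunction within `Tinit` steps. [folklore] -/
theorem initPhase_spec (hK : g.OK W) {m : ℕ → ℕ} (hR : g.BRegs m) (hD : ∀ a, 100 ≤ a → m a = g.base a) :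
    Achieves W O initPhase m (fun m' => g.BRegs m' ∧ ∀ a, 100 ≤ a → m' a = g.bheap [] [] a) g.Tinit := by
  unfold initPhase
  refine (Achieves.seqs_cons (g.guardA_spec hK hR hD) fun m₁ ⟨hR₁, hD₁⟩ =>
    Achieves.seqs_cons (g.guardB_spec hK hR₁ hD₁) fun m₂ ⟨hR₂, hD₂⟩ =>
    Achieves.seqs_cons (g.gadgetRows_spec hK hR₂ hD₂) fun m₃ ⟨hR₃, hD₃⟩ =>
    Achieves.seqs_cons (T₂ := 0) (g.header_spec hK hR₃ hD₃) fun m₄ h => Achieves.seqs_nil h).mono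
    (fun _ h => h) ?_
  unfold Tinit; ring_nf; omega

end initSpecs

end BP

end Literature.Computability.FineGrained.OVRed
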